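import Literature.Probability.RandomPlanarGeometry.SAWKestenBridgeMeasure
import Literature.Probability.RandomPlanarGeometry.SAWHalfSpaceConcat
import HarnessLib

/-!
# Cylinders of half-space walks: the decomposition `|F_n(ω) ∩ H_n| = Σ_{k=m}^{n} |E_k(ω)| h_{n-k} + R_n(ω)`
# at the first half-space renewal time `≥ m` (every `ℤ^d`)

Topic `Literature/Probability/RandomPlanarGeometry`, on top of `SAWKestenBridgeMeasure.lean` (Madras–Slade §8.3:
`Zd.bridgeExtCount d n m ω = |F_n(ω) ∩ B_n|`, `Zd.eCount d k m ω = |E_k(ω)|` = the `k`-step bridges extending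
`ω` with no renewal time in `[m, k)`, `Zd.kestenCyl` = Kesten's cylinder weight (8.3.6)), `SAWHalfSpaceConcat.lean`
(`Zd.concatWalk_mem_halfSpaceWalks`, `Zd.isRenewalTime_of_halfSpace_tail`) and `SAWBridgeRenewalEquation.lean`
(gluing / splitting API).

Sources. N. Madras, G. Slade (1993), Theorem 8.3.1, proof, eq. (8.3.5) (book p. 273): "`|F_n(ω) ∩ B_n| =
Σ_{i=m}^{n} |E_i(ω)| b_{n-i}`" (decomposition of the bridges extending `ω` at `M(β,ω)` = the first break point
`≥ m`). G. F. Lawler, O. Schramm, W. Werner (2004), Appendix "The infinite half-space SAW" (arXiv:math/0204277,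
p. 18): with `s(ω)` the least renewal time of a half-space walk ("`{s(ω) = k}` ↔ irreducible `k`-bridge ×
`Υ_{n-k}`"), "the infinite half-space SAW … is the same as the limit measure for bridges". What is proved here
(lane pcv-sawmu, planner route R27, item R27.6, combinatorial layer; every `ℤ^d`, `d ≥ 1`): the HALF-SPACE
analogue of (8.3.5), which carries a REMAINDER — **`|F_n(ω) ∩ H_n| = Σ_{k=m}^{n} |E_k(ω)|·h_{n-k} + R_n(ω)`**, where
`R_n(ω)` counts the `n`-step half-space walks extending `ω` with NO half-space renewal time in `[m, n]` (a
half-space renewal time `i` of `η ∈ H_n`: `η[0,i]` is a bridge and `η[i,n]` a half-space walk from `η(i)`). The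
bijection `E_k(ω) × H_{n-k} ↔ {η : least half-space renewal time ≥ m equals k}` is gluing/splitting at `k`; the
key equivalence is: for `i < k` with `η[0,k]` a bridge, `i` is a half-space renewal time of `η` iff `i` is a
(bridge) renewal time of `η[0,k]`. Also: `Σ_{ω ∈ S_m} |F_n(ω) ∩ H_n| = h_n` (`m ≤ n`).

## Contents (namespace `Literature.Probability.RandomPlanarGeometry.SAW.Zd`), all PROVED
* `halfSpaceExtCount d n m ω` — `|F_n(ω) ∩ H_n|` (verbatim the lane planner's typed object);
  `IsHalfSpaceRenewalTime n η i`; `halfSpaceNoRenewalCount d n m ω` — the remainder `R_n(ω)`;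
* `isHalfSpace_sub_const_iff`, `IsHalfSpace.of_bridge_append`, `head_mem_bridges_of_isBridge`,
  `tail_mem_halfSpaceWalks`, `isHalfSpaceRenewalTime_of_isRenewalTime_head`;
* `card_filter_leastHalfSpaceRenewal_eq` — `#{η ∈ H_n ext ω : least hs-renewal ≥ m is k} = |E_k(ω)|·h_{n-k}`;
* **`halfSpaceExtCount_eq_sum_add_noRenewal`** — the decomposition (8.3.5)-H with remainder;
* `sum_halfSpaceExtCount_eq` — `Σ_{ω ∈ S_m} |F_n(ω) ∩ H_n| = h_n`;
  `sum_halfSpaceNoRenewalCount_eq` — `Σ_{ω ∈ S_m} R_n(ω) = #{η ∈ H_n : no hs-renewal time in [m,n]}`.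
-/

noncomputable section

open Finset Literature.Probability.LatticeModels Literature.Probability.Percolation SimpleGraph
open scoped BigOperators

namespace Literature.Probability.RandomPlanarGeometry.SAW.Zd

variable {d : ℕ} [NeZero d]

/-! ### Objects -/

/-- `|F_n(ω) ∩ H_n|`: the number of `n`-step half-space walks `η` from the origin extending the `m`-step walk
`ω` (`η(j) = ω(j)` for `0 ≤ j ≤ m`). Body verbatim as the lane planner's typed object (a-idea-1
`Sketch_G6_KestenMeasureRate.lean`, `halfSpaceExtCount`, there on `ℤ^{d+2}`).
[cite: LawlerSchrammWerner2004SAW, Appendix (the uniform measure on Υ_n and its cylinders); MadrasSlade1993, §8.3, eq. (8.3.2)] -/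
def halfSpaceExtCount (d : ℕ) [NeZero d] (n m : ℕ) (ω : ℕ → Site d) : ℕ :=
  ((halfSpaceWalks d n).filter fun η : ℕ → Site d => ∀ j, j ≤ m → η j = ω j).card

/-- **Half-space renewal time**: `i ≤ n` with `η[0,i]` a bridge and `η[i,n]` a half-space walk from `η(i)`
(Lawler–Schramm–Werner's renewal times of a half-space walk; `s(η)` is the least positive one).
[cite: LawlerSchrammWerner2004SAW, Appendix ("let s(ω) denote …")] -/
def IsHalfSpaceRenewalTime (n : ℕ) (η : ℕ → Site d) (i : ℕ) : Prop :=
  i ≤ n ∧ IsBridge i η ∧ IsHalfSpace (n - i) (fun k => η (i + k))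

open Classical in
/-- The remainder `R_n(ω)`: `n`-step half-space walks extending `ω` with no half-space renewal time in `[m, n]`.
[cite: LawlerSchrammWerner2004SAW, Appendix; MadrasSlade1993, Theorem 8.3.1 (proof: "if such an i exists")] -/
def halfSpaceNoRenewalCount (d : ℕ) [NeZero d] (n m : ℕ) (ω : ℕ → Site d) : ℕ :=
  ((halfSpaceWalks d n).filter fun η : ℕ → Site d =>
    (∀ j, j ≤ m → η j = ω j) ∧ ∀ i, m ≤ i → i ≤ n → ¬ IsHalfSpaceRenewalTime n η i).card

/-! ### Half-space walk algebra -/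

/-- Translation invariance of the half-space condition (subtracting a constant). [cite: MadrasSlade1993, Definition 3.1.2] -/
theorem isHalfSpace_sub_const_iff {n : ℕ} {ω : ℕ → Site d} (c : Site d) :
    IsHalfSpace n (fun i => ω i - c) ↔ IsHalfSpace n ω := by
  simp only [IsHalfSpace, Pi.sub_apply, sub_lt_sub_iff_right]

/-- A bridge `η[0,s]` followed by a half-space walk `η[s,s+t]` (from `η(s)`) is a half-space walk `η[0,s+t]`.
[cite: LawlerSchrammWerner2004SAW, Appendix (concatenation of bridges and half-space walks)] -/
theorem IsHalfSpace.of_bridge_append {s t : ℕ} {η : ℕ → Site d} (h1 : IsBridge s η)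
    (h2 : IsHalfSpace t (fun k => η (s + k))) : IsHalfSpace (s + t) η := by
  have h0s : η 0 0 ≤ η s 0 := by
    rcases Nat.eq_zero_or_pos s with rfl | hs
    · exact le_rfl
    · exact (h1 s hs le_rfl).1.le
  intro i hi1 hi2
  rcases le_or_gt i s with his | his
  · exact (h1 i hi1 his).1
  · obtain ⟨j, rfl⟩ : ∃ j, i = s + j := ⟨i - s, by omega⟩
    have := h2 j (by omega) (by omega)
    dsimp only at this
    rw [add_zero] at this
    exact h0s.trans_lt this

/-- The head `i ↦ η (min i k)` of a self-avoiding walk whose piece `η[0,k]` is a bridge is a `k`-step bridge.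
[cite: MadrasSlade1993, §4.2 (splitting at a break point)] -/
theorem head_mem_bridges_of_isBridge {n k : ℕ} {η : ℕ → Site d} (hη : η ∈ saws d n) (hk : k ≤ n)
    (hb : IsBridge k η) : (fun i => η (min i k)) ∈ bridges d k := by
  obtain ⟨h0, -, hadj, hinj⟩ := mem_saws.1 hη
  refine mem_bridges.2 ⟨mem_saws.2 ⟨by simpa using h0, fun i hi => by simp [min_eq_right hi],
    fun i hi => ?_, fun i hi j hj hij => ?_⟩, hb.congr fun i hi => by simp only [min_eq_left hi]⟩
  · rw [min_eq_left hi.le, min_eq_left (Nat.succ_le_of_lt hi)]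
    exact hadj i (by omega)
  · simp only [Set.mem_setOf_eq] at hi hj
    dsimp only at hij
    rw [min_eq_left hi, min_eq_left hj] at hij
    exact hinj (by simp only [Set.mem_setOf_eq]; omega) (by simp only [Set.mem_setOf_eq]; omega) hij

omit [NeZero d] in
/-- The head `i ↦ η (min i m)` of an `n`-step self-avoiding walk is an `m`-step self-avoiding walk (`m ≤ n`).
[cite: MadrasSlade1993, Definition 7.1.1 (F_n(ω): the walks extending ω)] -/
theorem head_mem_saws {n m : ℕ} {η : ℕ → Site d} (hη : η ∈ saws d n) (hm : m ≤ n) :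
    (fun i => η (min i m)) ∈ saws d m := by
  obtain ⟨h0, -, hadj, hinj⟩ := mem_saws.1 hη
  refine mem_saws.2 ⟨by simpa using h0, fun i hi => by simp [min_eq_right hi], fun i hi => ?_,
    fun i hi j hj hij => ?_⟩
  · rw [min_eq_left hi.le, min_eq_left (Nat.succ_le_of_lt hi)]
    exact hadj i (by omega)
  · simp only [Set.mem_setOf_eq] at hi hj
    dsimp only at hij
    rw [min_eq_left hi, min_eq_left hj] at hij
    exact hinj (by simp only [Set.mem_setOf_eq]; omega) (by simp only [Set.mem_setOf_eq]; omega) hij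

/-- The shifted tail `j ↦ η (k + j) - η k` of a self-avoiding walk whose piece `η[k,n]` is a half-space walk is an
`(n-k)`-step half-space walk from the origin. [cite: LawlerSchrammWerner2004SAW, Appendix] -/
theorem tail_mem_halfSpaceWalks {n k : ℕ} {η : ℕ → Site d} (hη : η ∈ saws d n) (hk : k ≤ n)
    (hh : IsHalfSpace (n - k) (fun j => η (k + j))) : (fun j => η (k + j) - η k) ∈ halfSpaceWalks d (n - k) :=
  mem_halfSpaceWalks.2 ⟨tailShift_mem_saws hη hk, (isHalfSpace_sub_const_iff _).2 hh⟩

/-- If `k` is a half-space renewal time of `η` and `i ≤ k` is a (bridge) renewal time of the bridge `η[0,k]`,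
then `i` is a half-space renewal time of `η` (the tail `η[i,n]` is the bridge `η[i,k]` followed by the
half-space walk `η[k,n]`). [cite: LawlerSchrammWerner2004SAW, Appendix] -/
theorem isHalfSpaceRenewalTime_of_isRenewalTime_head {n k i : ℕ} {η : ℕ → Site d}
    (hk : IsHalfSpaceRenewalTime n η k) (hi : IsRenewalTime k η i) : IsHalfSpaceRenewalTime n η i := by
  obtain ⟨hkn, -, htail⟩ := hk
  obtain ⟨hik, hbi, hbik⟩ := hi
  refine ⟨hik.trans hkn, hbi, ?_⟩
  have h2 : IsHalfSpace (n - k) (fun j => (fun j' => η (i + j')) ((k - i) + j)) := by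
    have e : (fun j => (fun j' => η (i + j')) ((k - i) + j)) = fun j => η (k + j) := by
      funext j; dsimp only; rw [show i + (k - i + j) = k + j from by omega]
    rw [e]; exact htail
  have := IsHalfSpace.of_bridge_append hbik h2
  rwa [show k - i + (n - k) = n - i by omega] at this

/-! ### The bijection `E_k(ω) × H_{n-k} ↔ {η ∈ H_n ext ω : least half-space renewal time ≥ m is k}` -/

open Classical in
/-- For `m ≤ k ≤ n` and an `m`-step self-avoiding `ω`:
`#{η ∈ H_n : η ext ω, k is the least half-space renewal time ≥ m} = |E_k(ω)| · h_{n-k}`.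
[cite: MadrasSlade1993, Theorem 8.3.1 (proof, eq. (8.3.5)); LawlerSchrammWerner2004SAW, Appendix ("{s(ω) = k} ↔ irreducible bridge × Υ_{n-k}")] -/
theorem card_filter_leastHalfSpaceRenewal_eq {n m k : ℕ} (hmk : m ≤ k) (hkn : k ≤ n) {ω : ℕ → Site d}
    (hω : ω ∈ saws d m) :
    ((halfSpaceWalks d n).filter fun η : ℕ → Site d =>
        (∀ j, j ≤ m → η j = ω j) ∧ IsHalfSpaceRenewalTime n η k ∧
          ∀ i, m ≤ i → i < k → ¬ IsHalfSpaceRenewalTime n η i).card =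
      eCount d k m ω * halfSpaceCount d (n - k) := by
  classical
  have _ := hω
  -- the pieces: `E_k(ω) × H_{n-k}`
  set E : Finset (ℕ → Site d) := (bridges d k).filter fun β : ℕ → Site d =>
    (∀ j, j ≤ m → β j = ω j) ∧ ∀ i, m ≤ i → i < k → ¬ IsRenewalTime k β i with hE
  have hcardE : E.card = eCount d k m ω := by
    rw [hE, eCount]
  rw [← hcardE, halfSpaceCount, ← Finset.card_product]
  symm
  refine Finset.card_nbij (fun p : (ℕ → Site d) × (ℕ → Site d) => concatWalk k p.1 p.2) ?_ ?_ ?_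
  · -- the gluing lands in the target set
    rintro ⟨β, τ⟩ hp
    simp only [mem_coe, mem_product, hE, Finset.mem_filter] at hp
    obtain ⟨⟨hβ, hext, hnoren⟩, hτ⟩ := hp
    have hτ0 := (mem_saws.1 (mem_halfSpaceWalks.1 hτ).1).1
    have hmem := concatWalk_mem_halfSpaceWalks hβ hτ
    rw [Nat.add_sub_cancel' hkn] at hmem
    have hB : IsBridge k (concatWalk k β τ) := isBridge_concatWalk_left.2 (mem_bridges.1 hβ).2
    have hT : IsHalfSpace (n - k) (fun j => concatWalk k β τ (k + j)) := by
      have e : (fun j => concatWalk k β τ (k + j)) = fun j => β k + τ j :=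
        funext fun j => concatWalk_apply_add β τ hτ0 j
      rw [e, isHalfSpace_add_const_iff]
      exact (mem_halfSpaceWalks.1 hτ).2
    simp only [mem_coe, Finset.mem_filter]
    refine ⟨hmem, fun j hj => ?_, ⟨hkn, hB, hT⟩, fun i hmi hik hren => ?_⟩
    · rw [concatWalk_apply_of_le β τ (hj.trans hmk)]; exact hext j hj
    · -- an earlier half-space renewal time would be a renewal time of `β`
      have h1 : IsRenewalTime k (concatWalk k β τ) i :=
        isRenewalTime_of_halfSpace_tail hren.2.1 hB hik hkn hren.2.2
      have h2 : IsRenewalTime k β i := h1.congr fun i' hi' => by rw [concatWalk_apply_of_le β τ hi']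
      exact hnoren i hmi hik h2
  · -- injectivity
    rintro ⟨β, τ⟩ hp ⟨β', τ'⟩ hp' h
    simp only [mem_coe, mem_product, hE, Finset.mem_filter] at hp hp'
    dsimp only at h
    obtain ⟨h1, h2⟩ := concatWalk_injective_pieces (mem_bridges.1 hp.1.1).1 (mem_halfSpaceWalks.1 hp.2).1
      (mem_bridges.1 hp'.1.1).1 (mem_halfSpaceWalks.1 hp'.2).1 h
    rw [h1, h2]
  · -- surjectivity: split at `k`
    intro η hη
    rw [mem_coe, Finset.mem_filter] at hη
    obtain ⟨hηH, hext, hk, hmin⟩ := hη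
    have hηs := (mem_halfSpaceWalks.1 hηH).1
    refine ⟨⟨fun i => η (min i k), fun j => η (k + j) - η k⟩, ?_, concatWalk_head_tail η⟩
    simp only [mem_coe, mem_product, hE, Finset.mem_filter]
    refine ⟨⟨head_mem_bridges_of_isBridge hηs hkn hk.2.1, fun j hj => ?_, fun i hmi hik hren => ?_⟩,
      tail_mem_halfSpaceWalks hηs hkn hk.2.2⟩
    · simp only [min_eq_left (hj.trans hmk)]; exact hext j hj
    · have h1 : IsRenewalTime k η i := hren.congr fun i' hi' => by simp only [min_eq_left hi']
      exact hmin i hmi hik (isHalfSpaceRenewalTime_of_isRenewalTime_head hk h1)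

/-! ### The decomposition -/

/-- **`|F_n(ω) ∩ H_n| = Σ_{k=m}^{n} |E_k(ω)| h_{n-k} + R_n(ω)`** for an `m`-step self-avoiding `ω` (any `n`; for
`n < m` the sum is empty)
(the half-space analogue of Madras–Slade (8.3.5): split an extension `η ∈ H_n` of `ω` at its least half-space
renewal time `≥ m`, if any). [cite: MadrasSlade1993, Theorem 8.3.1 (proof, eq. (8.3.5)); LawlerSchrammWerner2004SAW, Appendix] -/
theorem halfSpaceExtCount_eq_sum_add_noRenewal {n m : ℕ} {ω : ℕ → Site d} (hω : ω ∈ saws d m) :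
    halfSpaceExtCount d n m ω =
      ∑ k ∈ Icc m n, eCount d k m ω * halfSpaceCount d (n - k) + halfSpaceNoRenewalCount d n m ω := by
  classical
  -- the extensions, split by "some half-space renewal time in [m,n]" or none
  set A : Finset (ℕ → Site d) := (halfSpaceWalks d n).filter fun η => ∀ j, j ≤ m → η j = ω j with hA
  set P : (ℕ → Site d) → ℕ → Prop := fun η i => m ≤ i ∧ i ≤ n ∧ IsHalfSpaceRenewalTime n η i with hP
  set Ak : ℕ → Finset (ℕ → Site d) := fun k => (halfSpaceWalks d n).filter fun η =>
    (∀ j, j ≤ m → η j = ω j) ∧ IsHalfSpaceRenewalTime n η k ∧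
      ∀ i, m ≤ i → i < k → ¬ IsHalfSpaceRenewalTime n η i with hAk
  have hA_eq : halfSpaceExtCount d n m ω = A.card := by rw [hA, halfSpaceExtCount]
  have hR_eq : halfSpaceNoRenewalCount d n m ω = (A.filter fun η => ¬ ∃ i, P η i).card := by
    rw [halfSpaceNoRenewalCount, hA, Finset.filter_filter]
    congr 1
    refine Finset.filter_congr fun η _ => ?_
    simp only [hP, not_exists, not_and]
  have hsplit := Finset.card_filter_add_card_filter_not (s := A) (fun η => ∃ i, P η i)
  -- the "some renewal" part is the disjoint union of the `Ak`, `k ∈ Icc m n`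
  have hunion : (A.filter fun η => ∃ i, P η i) = (Icc m n).biUnion Ak := by
    ext η
    simp only [hA, hAk, Finset.mem_filter, Finset.mem_biUnion, Finset.mem_Icc]
    constructor
    · rintro ⟨⟨hηH, hext⟩, hex⟩
      -- the least half-space renewal time `≥ m`
      have hex' : ∃ i, P η i := hex
      let k := Nat.find hex'
      have hk : P η k := Nat.find_spec hex'
      have hmin : ∀ i, i < k → ¬ P η i := fun i hi => Nat.find_min hex' hi
      refine ⟨k, ⟨hk.1, hk.2.1⟩, hηH, hext, hk.2.2, fun i hmi hik hren => hmin i hik ⟨hmi, ?_, hren⟩⟩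
      exact hren.1
    · rintro ⟨k, ⟨hmk, hkn⟩, hηH, hext, hren, -⟩
      exact ⟨⟨hηH, hext⟩, k, hmk, hkn, hren⟩
  have hdisj : Set.PairwiseDisjoint (↑(Icc m n) : Set ℕ) Ak := by
    intro k hk k' hk' hne
    rw [Function.onFun, Finset.disjoint_left]
    intro η h1 h2
    simp only [hAk, Finset.mem_filter] at h1 h2
    rw [Finset.mem_coe, Finset.mem_Icc] at hk hk'
    rcases lt_or_gt_of_ne hne with hlt | hlt
    · exact h2.2.2.2 k hk.1 hlt h1.2.2.1
    · exact h1.2.2.2 k' hk'.1 hlt h2.2.2.1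
  have hcards : ((Icc m n).biUnion Ak).card = ∑ k ∈ Icc m n, eCount d k m ω * halfSpaceCount d (n - k) := by
    rw [Finset.card_biUnion hdisj]
    refine Finset.sum_congr rfl fun k hk => ?_
    rw [Finset.mem_Icc] at hk
    exact card_filter_leastHalfSpaceRenewal_eq hk.1 hk.2 hω
  rw [hA_eq, hR_eq, ← hsplit, hunion, hcards]

/-! ### Summing over the cylinders -/

omit [NeZero d] in
/-- The prefix map `η ↦ η[0,m]` identifies "extends `ω`" with a fibre, for `ω ∈ S_m`. [cite: MadrasSlade1993, Definition 7.1.1] -/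
theorem forall_eq_iff_head_eq {n m : ℕ} {η ω : ℕ → Site d} (hω : ω ∈ saws d m) (_hη : η ∈ saws d n) :
    (∀ j, j ≤ m → η j = ω j) ↔ (fun i => η (min i m)) = ω := by
  obtain ⟨-, hωend, -, -⟩ := mem_saws.1 hω
  constructor
  · intro h
    funext i
    rcases le_or_gt i m with hi | hi
    · rw [min_eq_left hi, h i hi]
    · rw [min_eq_right hi.le, h m le_rfl, hωend i hi.le]
  · intro h j hj
    have := congrFun h j
    simpa [min_eq_left hj] using this

/-- **`Σ_{ω ∈ S_m} |F_n(ω) ∩ H_n| = h_n`** for `m ≤ n` (every `n`-step half-space walk extends exactly one `m`-step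
self-avoiding walk, its own head). [cite: MadrasSlade1993, §8.3 (the cylinder probabilities P_{m,n} form a probability law)] -/
theorem sum_halfSpaceExtCount_eq {n m : ℕ} (hmn : m ≤ n) :
    ∑ ω ∈ saws d m, halfSpaceExtCount d n m ω = halfSpaceCount d n := by
  classical
  rw [halfSpaceCount]
  have h := Finset.card_eq_sum_card_fiberwise (s := halfSpaceWalks d n) (t := saws d m)
    (f := fun η : ℕ → Site d => fun i => η (min i m)) fun η hη =>
      Finset.mem_coe.2 (head_mem_saws (mem_halfSpaceWalks.1 (Finset.mem_coe.1 hη)).1 hmn)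
  rw [h]
  refine Finset.sum_congr rfl fun ω hω => ?_
  rw [halfSpaceExtCount]
  congr 1
  refine Finset.filter_congr fun η hη => ?_
  exact forall_eq_iff_head_eq hω (mem_halfSpaceWalks.1 hη).1

open Classical in
/-- **`Σ_{ω ∈ S_m} R_n(ω) = #{η ∈ H_n : no half-space renewal time in [m, n]}`** (`m ≤ n`).
[cite: LawlerSchrammWerner2004SAW, Appendix; MadrasSlade1993, Theorem 8.3.1 (proof)] -/
theorem sum_halfSpaceNoRenewalCount_eq {n m : ℕ} (hmn : m ≤ n) :
    ∑ ω ∈ saws d m, halfSpaceNoRenewalCount d n m ω =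
      ((halfSpaceWalks d n).filter fun η : ℕ → Site d =>
        ∀ i, m ≤ i → i ≤ n → ¬ IsHalfSpaceRenewalTime n η i).card := by
  classical
  set S : Finset (ℕ → Site d) := (halfSpaceWalks d n).filter fun η : ℕ → Site d =>
    ∀ i, m ≤ i → i ≤ n → ¬ IsHalfSpaceRenewalTime n η i with hS
  have h := Finset.card_eq_sum_card_fiberwise (s := S) (t := saws d m)
    (f := fun η : ℕ → Site d => fun i => η (min i m)) fun η hη => by
      have hη' : η ∈ S := Finset.mem_coe.1 hη
      rw [hS, Finset.mem_filter] at hη'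
      exact Finset.mem_coe.2 (head_mem_saws (mem_halfSpaceWalks.1 hη'.1).1 hmn)
  rw [h]
  refine Finset.sum_congr rfl fun ω hω => ?_
  rw [halfSpaceNoRenewalCount, hS, Finset.filter_filter]
  congr 1
  refine Finset.filter_congr fun η hη => ?_
  rw [← forall_eq_iff_head_eq hω (mem_halfSpaceWalks.1 hη).1]
  exact ⟨fun h => ⟨h.2, h.1⟩, fun h => ⟨h.2, h.1⟩⟩

end Literature.Probability.RandomPlanarGeometry.SAW.Zd

end
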